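import Summits.BirchSwinnertonDyer.BirchSwinnertonDyer.Theorems.EdixhovenFibreFiveSevenStarredOptimalManinUnitFiveSevenAssemblyIntegralValuesCarayolFree
import Summits.BirchSwinnertonDyer.BirchSwinnertonDyer.Theorems.EdixhovenFibreFiveSevenStarredOptimalManinUnitFiveSevenSemiLocalIntegralityPin
import Literature.NumberTheory.EllipticCurves.Kato2004.EulerSystemSL2NeronValues
import Literature.NumberTheory.AdelicBaseChange.PadicTensorCompletionProofs
import HarnessLib

/-!
# F″ programme — THE FINAL ASSEMBLY: F″ ⟸ P1 + (S5b-tower) + [Kato II Prop. 1.2.3] + [de Rham] (Carayol-free)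
# (route `EdixhovenFibreFiveSeven`, crux K★ `StarredOptimalManinUnitFiveSeven` stmt-BirchSwinnertonDyer-22226, line
# `kato-lever`; `--supports` 22226, helper; text = edix-p4 g3's turnkey `Cruxes/…/Lines/kato_lever_final_assembly_turnkey.lean`
# PART B with its one `sorry` replaced by P4-coh part 2, seat edix-p3 g4)

TOOL theorem only (no definition, no named fact, no `sorry`); the four inputs are cite-only Literature facts DISPLAYED as
hypotheses (edix-p5 g3's Carayol-free socket `KatoCarayolFree.kato_neron_five_le_of_integralSL2NeronValues'`, p603961, removes
[level = conductor]); nothing is closed or booked (K★ 22226 / TDS57 22227 / KP57 23810 / AKR #7 20709 become conditional results on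
exactly these facts through their landed `…_of_kato` closers); BSD is not proved by any of this.

References: [Kato2004Asterisque] (8.1.3) p. 180, §8.3 p. 181, Thm. 9.7 p. 189, Thm. 6.6 (1) p. 163, Thm. 13.6 p. 227;
[Kato1993LNM1553] Ch. II §1.2.4, Thm. 1.4.1; [BlochKato1990] Prop. 3.8, Ex. 3.11; [KimNakamura2020] Cor. 2.4; [Carayol1986].
-/

set_option autoImplicit false
-- the Theorems namespace of a single-conjunct summit repeats the summit name by design (D-0017)
set_option linter.dupNamespace false

noncomputable section


open scoped MatrixGroups ModularForm Classical NumberField TensorProduct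
open CongruenceSubgroup WeierstrassCurve IsDedekindDomain NumberField
open Literature.NumberTheory.GaloisRepresentations
open Literature.NumberTheory.EllipticCurves Literature.NumberTheory.EllipticCurves.ModularForms
open Literature.NumberTheory.EllipticCurves.Kato2004 Literature.NumberTheory.EllipticCurves.Kato2004.EulerSystemValues
open Literature.NumberTheory.EllipticCurves.Rank1Residual

namespace Summit.BirchSwinnertonDyer.BirchSwinnertonDyer.Theorems.KatoAssemblySocket

/-- `gcd(m, pN) = 1 ⟹ p ∤ m` for a prime `p`. [folklore] -/
theorem not_dvd_of_coprime_mul {p N m : ℕ} [hp : Fact p.Prime] (h : m.Coprime (p * N)) : ¬ p ∣ m := by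
  intro hpm
  have h1 : p ∣ Nat.gcd m (p * N) := Nat.dvd_gcd hpm (dvd_mul_right p N)
  rw [h, Nat.dvd_one] at h1
  exact hp.out.ne_one h1

set_option backward.isDefEq.respectTransparency false in
/-- ★★★ **THE FINAL ASSEMBLY: F″ ⟸ P1 + (S5b-tower) + [Kato II 1.2.3] + [de Rham]** (Carayol-free).
Kato's Néron-twisted integrality `kato_neron_isIntegral_twistedSymbolSum_of_additive_five_le` (the ONE stub of K★'s
registered skeleton, and the binder of TDS57 / KP57 / AKR #7) follows from the cite-only facts
`exists_member_sl2ZetaElement_neron_values` (P1: Kato (8.1.3) + Thm. 9.7 + Thm. 6.6 (1) + Thm. 13.6 at Kato's member,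
Néron-pinned; p603032), (S5b-tower) `exists_smul_range_expStarCoord_tower_iff_trace_log`, the Prop-1.2.3 / de Rham
facts `cupLogInjective_and_hasDualExp_of_isDeRham`, `isDeRham_restrictedRationalTateRep` (NO level fact: Carayol-free socket p603961) —
by `KatoCarayolFree.kato_neron_five_le_of_integralSL2NeronValues'` (p603961; hlev-free twin of p602985) fed with P1's data, the semi-local isomorphism of
`AdelicBaseChange.exists_padicTensorAlgEquiv`, and P4-coh (`SemiLocalIntegrality.semilocal_mem_adicCompletionIntegers_of_pin_of_semi`,
seat edix-p3 g4) for the integrality clause.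
[cite: Kato2004Asterisque, (8.1.3) (p. 180), §8.3 (p. 181), Thm. 9.7 (p. 189), Thm. 6.6 (1) (p. 163), Thm. 13.6 (p. 227)]
[cite: Kato1993LNM1553, Ch. II §1.2.4 and Thm. 1.4.1 (3)-(4)] [cite: BlochKato1990, Prop. 3.8 and Example 3.11]
[cite: KimNakamura2020, Cor. 2.4] -/
theorem kato_neron_five_le_of_sl2NeronValues
    (hT₂ : Literature.NumberTheory.PAdicHodge.exists_smul_range_expStarCoord_tower_iff_trace_log)
    (hP : Literature.NumberTheory.PAdicHodge.cupLogInjective_and_hasDualExp_of_isDeRham)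
    (hDR : Literature.NumberTheory.PAdicHodge.isDeRham_restrictedRationalTateRep)
    (hP1 : exists_member_sl2ZetaElement_neron_values) :
    kato_neron_isIntegral_twistedSymbolSum_of_additive_five_le := by
  refine KatoCarayolFree.kato_neron_five_le_of_integralSL2NeronValues' fun W _ p _ ↦ ?_
  obtain ⟨W', hE, hM, hiso, h⟩ := hP1 W p
  refine ⟨W', hE, hM, hiso, ?_⟩
  intro _ _ _ N _ f hf
  obtain ⟨d₀, hPIN, n, hN, hm⟩ := h f hf
  refine ⟨n, hN, fun m _ ↦ ?_⟩
  obtain ⟨ι, Λ, hSEMI, hVAL⟩ := hm m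
  obtain ⟨Ψ, hΨ⟩ := Literature.NumberTheory.AdelicBaseChange.exists_padicTensorAlgEquiv (CyclotomicField m ℚ) p
  refine ⟨ι, Λ, Ψ, hΨ, fun hp5 hg hmu hcop hcl y w ↦ ?_, hVAL⟩
  exact SemiLocalIntegrality.semilocal_mem_adicCompletionIntegers_of_pin_of_semi p hT₂ hP hDR W' hp5 ⟨hg, hmu⟩ d₀ hPIN m
    (not_dvd_of_coprime_mul hcop) hcl Λ Ψ (hSEMI Ψ hΨ) y w

end Summit.BirchSwinnertonDyer.BirchSwinnertonDyer.Theorems.KatoAssemblySocket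

end
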